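import Literature.Probability.RandomPlanarGeometry.BrownianBridgeSplittingLaw
import Literature.Probability.RandomPlanarGeometry.BrownianLoopSplittingCalculus
import HarnessLib

/-!
# Splitting the rooted Brownian loop at a fixed time fraction: two independent bridges

Lawler, *Conformally Invariant Processes in the Plane* (2005), §5.2: the finite measures
`μ(z, w; t)` on paths of duration `t` from `z` to `w` (`|μ(z, w; t)| = p_t(z, w)`, and
`μ^#(z, w; t) = μ(z, w; t)/p_t(z, w)` the bridge probability) satisfy the Chapman–Kolmogorov
relation "`μ(z, w; s + t) = ∫ [μ(z, z'; s) ⊕ μ(z', w; t)] dA(z')`". For the rooted Brownian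
loop of duration `t` at `z`, realised as `γ_{z,t,ω}(r) = z + √t η_ω(r)` with the planar unit
bridge `η` (`BrownianLoopMeasure`), and a time fraction `u ∈ (0, 1)`, this is the statement
proved here (`lintegral_pieces_eq`): **the law of the pair (loop on `[0, tu]`, loop on
`[tu, t]`), each piece in unit-time parametrisation, is
`∫ p_{tu(1−u)}(z, w) [Bridge_{tu}(z → w) ⊗ Bridge_{t(1−u)}(w → z)] dA(w)`** — the junction
point `w = γ(u)` has the Gaussian density `p_{tu(1−u)}(z, ·)` and, given `w`, the two pieces
are independent Brownian bridges (`bridgeFun z w (s, ω) = z + v(w − z) + √s η_ω(v)`).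
Ingredients: the Gaussian splitting `map_split_triple` (`BrownianBridgeSplittingLaw`), the
density of `η_u` (`BrownianBridgeValueLaw`) and the affine Gaussian change of variables
`lintegral_heat_affine` (`BrownianLoopSplittingCalculus`).

## References

* G. F. Lawler, *Conformally Invariant Processes in the Plane*, AMS (2005), §5.2.
-/

noncomputable section

open Set MeasureTheory ProbabilityTheory unitInterval
open scoped unitInterval NNReal ENNReal

namespace Literature.Probability.RandomPlanarGeometry

open Literature.Probability.Process (WienerPair wienerPair)

namespace BrownianLoop

/-- **The Brownian bridge of duration `s` from `z` to `w` in unit-time parametrisation**, driven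
by the planar unit bridge `η_ω`: `v ↦ z + v(w − z) + √s η_ω(v)` ([Lawler] §5.2, the
probability measure `μ^#(z, w; s)` realised on the Wiener pair). [cite: Lawler2005ConformallyInvariant, §5.2] -/
def bridgeFun (z w : ℂ) (q : ℝ × WienerPair) (v : I) : ℂ :=
  z + ((v : ℝ) : ℂ) * (w - z) + (Real.sqrt q.1 : ℂ) * unitBridge q.2 v

/-- `bridgeFun` starts at `z`. [folklore] -/
theorem bridgeFun_zero (z w : ℂ) (q : ℝ × WienerPair) : bridgeFun z w q 0 = z := by
  simp [bridgeFun, unitBridge_zero]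

/-- `bridgeFun` ends at `w`. [folklore] -/
theorem bridgeFun_one (z w : ℂ) (q : ℝ × WienerPair) : bridgeFun z w q 1 = w := by
  simp [bridgeFun, unitBridge_one]

/-- Joint measurability of `bridgeFun` in (start, end, duration, sample). [folklore] -/
theorem measurable_bridgeFun :
    Measurable fun r : ℂ × ℂ × ℝ × WienerPair ↦ bridgeFun r.1 r.2.1 r.2.2 := by
  refine measurable_pi_lambda _ fun v ↦ ?_
  unfold bridgeFun
  have h1 : Measurable fun r : ℂ × ℂ × ℝ × WienerPair ↦ unitBridge r.2.2.2 v :=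
    (measurable_unitBridge v).comp (measurable_snd.comp (measurable_snd.comp measurable_snd))
  have h2 : Measurable fun r : ℂ × ℂ × ℝ × WienerPair ↦ (Real.sqrt r.2.2.1 : ℂ) :=
    Complex.measurable_ofReal.comp ((measurable_fst.comp (measurable_snd.comp measurable_snd)).sqrt)
  fun_prop

variable (z : ℂ) {t : ℝ} {u : I}

/-- The two pieces of the rooted loop in terms of the splitting triple `(A, C, η_u)`:
`γ_{z,t,ω}(uv) = z + √t (A_v + v η_u)`, `γ_{z,t,ω}(u + (1−u)v) = z + √t (C_v + (1 − v) η_u)`.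
[folklore] -/
theorem rootedFun_fstTime (ω : WienerPair) (v : I) :
    rootedFun (z, t, ω) (fstTime u v) = z + (Real.sqrt t : ℂ) *
      ((unitBridge ω (fstTime u v) - (v : ℝ) • unitBridge ω u) + ((v : ℝ) : ℂ) * unitBridge ω u) := by
  rw [rootedFun, Complex.real_smul, sub_add_cancel]

/-- See `rootedFun_fstTime`. [folklore] -/
theorem rootedFun_sndTime (ω : WienerPair) (v : I) :
    rootedFun (z, t, ω) (sndTime u v) = z + (Real.sqrt t : ℂ) *
      ((unitBridge ω (sndTime u v) - (1 - (v : ℝ)) • unitBridge ω u) +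
        ((1 - (v : ℝ) : ℝ) : ℂ) * unitBridge ω u) := by
  rw [rootedFun, Complex.real_smul, sub_add_cancel]

/-- **Splitting the rooted loop at the time fraction `u ∈ (0,1)`** ([Lawler] §5.2,
Chapman–Kolmogorov for the bridge measures, at the level of the unit-time parametrised pieces):
for measurable `Φ ≥ 0` of the two pieces (each recorded with its duration),
`E[Φ((γ|[0,tu], tu), (γ|[tu,t], t(1−u)))] = ∫ p_{tu(1−u)}(w − z) E⊗E[Φ((bridge_{tu}(z→w), tu),
(bridge_{t(1−u)}(w→z), t(1−u)))] dA(w)`. [cite: Lawler2005ConformallyInvariant, §5.2] -/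
theorem lintegral_pieces_eq (ht : 0 < t) (h0 : 0 < (u : ℝ)) (h1 : (u : ℝ) < 1)
    {Φ : ((I → ℂ) × ℝ) × ((I → ℂ) × ℝ) → ℝ≥0∞} (hΦ : Measurable Φ) :
    ∫⁻ ω, Φ (((fun v ↦ rootedFun (z, t, ω) (fstTime u v)), t * u),
        ((fun v ↦ rootedFun (z, t, ω) (sndTime u v)), t * (1 - u))) ∂wienerPair =
      ∫⁻ w, heat (t * ((u : ℝ) - (u : ℝ) ^ 2)) (w - z) *
        ∫⁻ ω₁, ∫⁻ ω₂, Φ ((bridgeFun z w (t * u, ω₁), t * u),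
          (bridgeFun w z (t * (1 - u), ω₂), t * (1 - u))) ∂wienerPair ∂wienerPair := by
  have hv : 0 < (u : ℝ) - (u : ℝ) ^ 2 := by nlinarith
  -- the assembling map `Ψ` from the triple `(a, (c, y))` to the two pieces
  set Ψ : (I → ℂ) × ((I → ℂ) × ℂ) → ((I → ℂ) × ℝ) × ((I → ℂ) × ℝ) := fun x ↦
    (((fun v ↦ z + (Real.sqrt t : ℂ) * (x.1 v + ((v : ℝ) : ℂ) * x.2.2)), t * u),
      ((fun v ↦ z + (Real.sqrt t : ℂ) * (x.2.1 v + ((1 - (v : ℝ) : ℝ) : ℂ) * x.2.2)), t * (1 - u)))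
    with hΨ
  have hΨm : Measurable Ψ := by
    refine ((measurable_pi_lambda _ fun v ↦ ?_).prodMk measurable_const).prodMk
      ((measurable_pi_lambda _ fun v ↦ ?_).prodMk measurable_const)
    · exact measurable_const.add (measurable_const.mul (((measurable_pi_apply v).comp
        measurable_fst).add (measurable_const.mul (measurable_snd.comp measurable_snd))))
    · exact measurable_const.add (measurable_const.mul (((measurable_pi_apply v).comp
        (measurable_fst.comp measurable_snd)).add
          (measurable_const.mul (measurable_snd.comp measurable_snd))))
  -- the splitting triple
  set T : WienerPair → (I → ℂ) × ((I → ℂ) × ℂ) := fun ω ↦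
    ((fun v : I ↦ unitBridge ω (fstTime u v) - (v : ℝ) • unitBridge ω u),
      ((fun v : I ↦ unitBridge ω (sndTime u v) - (1 - (v : ℝ)) • unitBridge ω u),
        unitBridge ω u)) with hT
  have hTm : Measurable T :=
    (measurable_splitFstC u).prodMk ((measurable_splitSndC u).prodMk (measurable_unitBridge u))
  have hpieces : ∀ ω, (((fun v ↦ rootedFun (z, t, ω) (fstTime u v)), t * (u : ℝ)),
      ((fun v ↦ rootedFun (z, t, ω) (sndTime u v)), t * (1 - (u : ℝ)))) = Ψ (T ω) := by
    intro ω
    simp only [hΨ, hT, rootedFun_fstTime, rootedFun_sndTime]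
  simp_rw [hpieces]
  have hΦΨ : Measurable fun x ↦ Φ (Ψ x) := hΦ.comp hΨm
  have e1 : ∫⁻ ω, Φ (Ψ (T ω)) ∂wienerPair = ∫⁻ x, Φ (Ψ x) ∂(wienerPair.map T) :=
    (lintegral_map hΦΨ hTm).symm
  rw [e1, show wienerPair.map T = _ from map_split_triple u, lintegral_prod _ hΦΨ.aemeasurable]
  -- laws of the pieces as images of the unit bridge; law of `η_u` as a density
  have hsc : ∀ c : ℝ, Measurable fun (ω : WienerPair) (v : I) ↦ (c : ℂ) * unitBridge ω v := fun c ↦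
    measurable_pi_lambda _ fun v ↦ (measurable_unitBridge v).const_mul _
  have hin : ∀ a : I → ℂ, Measurable fun p : (I → ℂ) × ℂ ↦ Φ (Ψ (a, p)) := fun a ↦
    hΦΨ.comp (measurable_const.prodMk measurable_id)
  have e2 : ∫⁻ a, ∫⁻ p, Φ (Ψ (a, p))
      ∂((wienerPair.map (fun ω (v : I) ↦ (Real.sqrt (1 - u) : ℂ) * unitBridge ω v)).prod
          (wienerPair.map (fun ω ↦ unitBridge ω u)))
      ∂(wienerPair.map (fun ω (v : I) ↦ (Real.sqrt u : ℂ) * unitBridge ω v)) =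
      ∫⁻ ω₁, ∫⁻ p, Φ (Ψ ((fun v ↦ (Real.sqrt u : ℂ) * unitBridge ω₁ v), p))
      ∂((wienerPair.map (fun ω (v : I) ↦ (Real.sqrt (1 - u) : ℂ) * unitBridge ω v)).prod
          (wienerPair.map (fun ω ↦ unitBridge ω u))) ∂wienerPair :=
    lintegral_map hΦΨ.lintegral_prod_right' (hsc _)
  rw [e2]
  have step : ∀ ω₁ : WienerPair,
      ∫⁻ p, Φ (Ψ ((fun v ↦ (Real.sqrt u : ℂ) * unitBridge ω₁ v), p))
        ∂((wienerPair.map (fun ω (v : I) ↦ (Real.sqrt (1 - u) : ℂ) * unitBridge ω v)).prod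
          (wienerPair.map (fun ω ↦ unitBridge ω u))) =
      ∫⁻ ω₂, ∫⁻ y, heat ((u : ℝ) - (u : ℝ) ^ 2) y *
        Φ (Ψ ((fun v ↦ (Real.sqrt u : ℂ) * unitBridge ω₁ v),
          ((fun v ↦ (Real.sqrt (1 - u) : ℂ) * unitBridge ω₂ v), y))) ∂volume ∂wienerPair := by
    intro ω₁
    rw [lintegral_prod _ (hin _).aemeasurable]
    have e3 : ∫⁻ c, ∫⁻ y, Φ (Ψ ((fun v ↦ (Real.sqrt u : ℂ) * unitBridge ω₁ v), (c, y)))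
        ∂(wienerPair.map (fun ω ↦ unitBridge ω u))
        ∂(wienerPair.map (fun ω (v : I) ↦ (Real.sqrt (1 - u) : ℂ) * unitBridge ω v)) =
        ∫⁻ ω₂, ∫⁻ y, Φ (Ψ ((fun v ↦ (Real.sqrt u : ℂ) * unitBridge ω₁ v),
          ((fun v ↦ (Real.sqrt (1 - u) : ℂ) * unitBridge ω₂ v), y)))
          ∂(wienerPair.map (fun ω ↦ unitBridge ω u)) ∂wienerPair :=
      lintegral_map (hin _).lintegral_prod_right' (hsc _)
    rw [e3]
    refine lintegral_congr fun ω₂ ↦ ?_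
    rw [map_unitBridge_eval_eq_withDensity h0 h1]
    exact lintegral_withDensity_eq_lintegral_mul _ (measurable_heat_right _)
      ((hin _).comp (measurable_const.prodMk measurable_id))
  simp_rw [step]
  -- the function of (ω₁, ω₂, y) being integrated, and the target function of `w`
  set M : WienerPair × WienerPair × ℂ → ℝ≥0∞ := fun r ↦ heat ((u : ℝ) - (u : ℝ) ^ 2) r.2.2 *
    Φ (Ψ ((fun v ↦ (Real.sqrt u : ℂ) * unitBridge r.1 v),
      ((fun v ↦ (Real.sqrt (1 - u) : ℂ) * unitBridge r.2.1 v), r.2.2))) with hM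
  have hMm : Measurable M := by
    refine ((measurable_heat_right _).comp (measurable_snd.comp measurable_snd)).mul
      (hΦ.comp (hΨm.comp ?_))
    exact (measurable_pi_lambda _ fun v ↦ ((measurable_unitBridge v).comp measurable_fst).const_mul _)
      |>.prodMk ((measurable_pi_lambda _ fun v ↦
        ((measurable_unitBridge v).comp (measurable_fst.comp measurable_snd)).const_mul _).prodMk
          (measurable_snd.comp measurable_snd))
  set J : ℂ × WienerPair × WienerPair → ℝ≥0∞ := fun r ↦ Φ ((bridgeFun z r.1 (t * u, r.2.1), t * u),
    (bridgeFun r.1 z (t * (1 - u), r.2.2), t * (1 - u))) with hJ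
  have hJm : Measurable J := by
    refine hΦ.comp ((Measurable.prodMk ?_ measurable_const).prodMk
      (Measurable.prodMk ?_ measurable_const))
    · exact measurable_bridgeFun.comp (measurable_const.prodMk (measurable_fst.prodMk
        (measurable_const.prodMk (measurable_fst.comp measurable_snd))))
    · exact measurable_bridgeFun.comp (measurable_fst.prodMk (measurable_const.prodMk
        (measurable_const.prodMk (measurable_snd.comp measurable_snd))))
  set G : ℂ → ℝ≥0∞ := fun w ↦ ∫⁻ ω₁, ∫⁻ ω₂, J (w, ω₁, ω₂) ∂wienerPair ∂wienerPair with hG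
  have h4 : Measurable fun p : ℂ × WienerPair ↦ ∫⁻ ω₂, J (p.1, p.2, ω₂) ∂wienerPair := by
    have h5 : Measurable fun r : (ℂ × WienerPair) × WienerPair ↦ J (r.1.1, r.1.2, r.2) :=
      hJm.comp ((measurable_fst.comp measurable_fst).prodMk
        ((measurable_snd.comp measurable_fst).prodMk measurable_snd))
    exact h5.lintegral_prod_right'
  have hGm : Measurable G := h4.lintegral_prod_right'
  -- move the `y`-integral outside
  have hswap : ∫⁻ ω₁, ∫⁻ ω₂, ∫⁻ y, M (ω₁, ω₂, y) ∂volume ∂wienerPair ∂wienerPair =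
      ∫⁻ y, ∫⁻ ω₁, ∫⁻ ω₂, M (ω₁, ω₂, y) ∂wienerPair ∂wienerPair ∂volume := by
    calc ∫⁻ ω₁, ∫⁻ ω₂, ∫⁻ y, M (ω₁, ω₂, y) ∂volume ∂wienerPair ∂wienerPair
        = ∫⁻ ω₁, ∫⁻ y, ∫⁻ ω₂, M (ω₁, ω₂, y) ∂wienerPair ∂volume ∂wienerPair := by
          refine lintegral_congr fun ω₁ ↦ ?_
          exact lintegral_lintegral_swap
            ((hMm.comp (measurable_const.prodMk measurable_id)).aemeasurable)
      _ = ∫⁻ y, ∫⁻ ω₁, ∫⁻ ω₂, M (ω₁, ω₂, y) ∂wienerPair ∂wienerPair ∂volume := by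
          refine lintegral_lintegral_swap (Measurable.aemeasurable ?_)
          have h3 : Measurable fun r : (WienerPair × ℂ) × WienerPair ↦ M (r.1.1, r.2, r.1.2) :=
            hMm.comp ((measurable_fst.comp measurable_fst).prodMk
              (measurable_snd.prodMk (measurable_snd.comp measurable_fst)))
          exact h3.lintegral_prod_right'
  have eM : ∀ ω₁ ω₂ y, heat ((u : ℝ) - (u : ℝ) ^ 2) y *
      Φ (Ψ ((fun v ↦ (Real.sqrt u : ℂ) * unitBridge ω₁ v),
        ((fun v ↦ (Real.sqrt (1 - u) : ℂ) * unitBridge ω₂ v), y))) = M (ω₁, ω₂, y) :=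
    fun _ _ _ ↦ rfl
  simp_rw [eM]
  rw [hswap]
  -- identify the inner double integral with `heat · G (z + √t y)` and change variables
  have hsq1 : (Real.sqrt (t * u) : ℂ) = (Real.sqrt t : ℂ) * (Real.sqrt u : ℂ) := by
    rw [Real.sqrt_mul ht.le, Complex.ofReal_mul]
  have hsq2 : (Real.sqrt (t * (1 - u)) : ℂ) = (Real.sqrt t : ℂ) * (Real.sqrt (1 - u) : ℂ) := by
    rw [Real.sqrt_mul ht.le, Complex.ofReal_mul]
  have key : ∀ ω₁ ω₂ y, M (ω₁, ω₂, y) =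
      heat ((u : ℝ) - (u : ℝ) ^ 2) y * J (z + (Real.sqrt t : ℂ) * y, ω₁, ω₂) := by
    intro ω₁ ω₂ y
    simp only [hM, hJ]
    congr 1
    congr 1
    simp only [hΨ]
    refine Prod.ext (Prod.ext (funext fun v ↦ ?_) rfl) (Prod.ext (funext fun v ↦ ?_) rfl)
    · simp only [bridgeFun, hsq1]
      ring
    · simp only [bridgeFun, hsq2]
      push_cast
      ring
  have hne : ∀ y, heat ((u : ℝ) - (u : ℝ) ^ 2) y ≠ ∞ := fun y ↦
    ENNReal.mul_ne_top ENNReal.ofReal_ne_top ENNReal.ofReal_ne_top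
  have hinner : ∀ y, ∫⁻ ω₁, ∫⁻ ω₂, M (ω₁, ω₂, y) ∂wienerPair ∂wienerPair =
      heat ((u : ℝ) - (u : ℝ) ^ 2) y * G (z + (Real.sqrt t : ℂ) * y) := by
    intro y
    simp_rw [key]
    simp_rw [lintegral_const_mul' _ _ (hne y)]
    rfl
  simp_rw [hinner]
  exact lintegral_heat_affine ht hv z hGm

end BrownianLoop

end Literature.Probability.RandomPlanarGeometry

end
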